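import Literature.Computability.QuantumComplexity.ForrelationMSubspaceDuality
import Summits.QuantumAdvantage.QuantumAdvantage.Theorems.CubicForrelationSignedExactCubicForrelationNotPrBPPStubPolarGeometry

/-!
# Crux `CubicForrelation.SignedExactCubicForrelationNotPrBPP` (stmt-QuantumAdvantage-13932), line `dual-pingpong-frame`
# (GROW reshape): stub `stub_spanningOfNoDual` — no common annihilator ⇒ spanning

Support file (`--supports stmt-QuantumAdvantage-13932`). The radical-visible case of the reshaped kernel
statistics uses `r = n + 1` random probes `xs : Fin r → 𝔽₂ⁿ` and needs the elementary duality fact: if the only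
vector `w` with even overlap with every `xs j` is `w = 0`, then the tuple SPANS `𝔽₂ⁿ` — phrased without linear
algebra: every `⊕`-closed finset `W ∋ 0` containing all the `xs j` is the whole space. Proof: if `W ≠ univ`
then `|W| < 2ⁿ`, and `|W|·|W^⊥| = 2ⁿ` (`DerivativeWalsh.card_mul_card_perp`) forces `|W^⊥| ≥ 2`, so some
`w ≠ 0` lies in `W^⊥`; it is orthogonal to every `xs j`, hence `w = 0` by hypothesis — contradiction.

* `one_lt_card_perp_of_card_lt` — a proper `⊕`-closed `W ∋ 0` has `|W^⊥| ≥ 2`;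
* `stub_spanningOfNoDual` — verbatim the registered stub.

References: R. O'Donnell, *Analysis of Boolean Functions*, CUP 2014, §3.3 (orthogonal complements of
subspaces of `𝔽₂ⁿ`, `|U|·|U^⊥| = 2ⁿ`) [ODonnell2014]. -/

noncomputable section

set_option linter.dupNamespace false -- D-0017: single-problem summit ⇒ `QuantumAdvantage.QuantumAdvantage` by design

namespace Summit.QuantumAdvantage.QuantumAdvantage.Theorems.SignedExactCubicForrelationNotPrBPP

open Finset
open Literature.Computability.Complexity Literature.Computability.QuantumComplexity
open Literature.Computability.QuantumComplexity.BuzetChailloux (bxor zeroVec)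

/-- A proper `⊕`-closed finset `W ∋ 0` of `𝔽₂ⁿ` has at least two vectors in its orthogonal `W^⊥`
(`|W|·|W^⊥| = 2ⁿ` with `|W| < 2ⁿ` rules out `|W^⊥| ≤ 1`). [cite: ODonnell2014, §3.3] -/
theorem one_lt_card_perp_of_card_lt {n : ℕ} {W : Finset (Fin n → Bool)} (h0 : zeroVec ∈ W)
    (hadd : ∀ x ∈ W, ∀ y ∈ W, bxor x y ∈ W) (hlt : W.card < 2 ^ n) :
    1 < (univ.filter fun y => ∀ x ∈ W, twist x y = 1).card := by
  have h := DerivativeWalsh.card_mul_card_perp h0 hadd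
  have hN : W.card * (univ.filter fun y => ∀ x ∈ W, twist x y = 1).card = 2 ^ n := by exact_mod_cast h
  by_contra hle
  rw [not_lt] at hle
  have h1 := Nat.mul_le_mul_left W.card hle
  rw [hN, mul_one] at h1
  exact absurd hlt (not_lt.2 h1)

/-- **No common annihilator ⇒ spanning** (registered stub `stub_spanningOfNoDual` of line `dual-pingpong-frame`).
If the only `w` with even overlap with every `xs j` is `0`, then every `⊕`-closed finset containing `0` and all
the `xs j` is all of `𝔽₂ⁿ`: a proper such `W` has a non-zero `w ∈ W^⊥` (`one_lt_card_perp_of_card_lt`), which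
is orthogonal to every `xs j ∈ W`. [cite: ODonnell2014, §3.3] -/
theorem stub_spanningOfNoDual :
    ∀ (n r : ℕ) (xs : Fin r → (Fin n → Bool)),
      (∀ w : Fin n → Bool, (∀ j, ((Finset.univ.filter fun i => w i && xs j i).card).bodd = false) → w = zeroVec) →
      ∀ W : Finset (Fin n → Bool), zeroVec ∈ W → (∀ x ∈ W, ∀ y ∈ W, bxor x y ∈ W) → (∀ j, xs j ∈ W) → W = Finset.univ := by
  intro n r xs hdual W h0 hadd hxs
  by_contra hne
  have hlt : W.card < 2 ^ n := by
    have := card_lt_card (ssubset_univ_iff.2 hne)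
    rwa [card_univ, Fintype.card_fun, Fintype.card_bool, Fintype.card_fin] at this
  obtain ⟨w, hwP, hwne⟩ := exists_mem_ne (one_lt_card_perp_of_card_lt h0 hadd hlt) zeroVec
  refine hwne (hdual w fun j => ?_)
  rw [PolarGeometry.bdot_comm]
  exact (PolarGeometry.twist_eq_one_iff_bdot _ _).1 ((mem_filter.1 hwP).2 _ (hxs j))

end Summit.QuantumAdvantage.QuantumAdvantage.Theorems.SignedExactCubicForrelationNotPrBPP

end
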